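/-
Copyright (c) 2026 the pub-hodgecm2 formalisation cell (harness21).  New file.
Origin: seat `prover-pub-hodgecm-own-htheta-g10-0` (unit pub-hodgecm-own-htheta, gen 10; Δ2 consultant for the δ′ ∕ Ω rows), 2026-08-23 — VERSION-B:
at the model's μ-uniform carriers `Model.uniformOmegaRep … δ′ r` (`Transposition/Item6UniformOmegaRep.lean`) the two Prop-binders `h411` ∕ `hsep` of the
Prop-4.13 multiplicity pay-off (S∞ thm 3 `…thm418C_of_asPrinted_of_prop413AsPrinted_small`) are the END's DISPLAYED AS-PRINTED FAMILIES at the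
generic Liu rests `restOfCharRep … δ′ (r μ hμ) μ hμ hw` — [Liu2021, Def. 4.11] (`Def411AsPrinted`) and [Liu2021, Thm. 4.18 (2)] (a clause of the
displayed `hLiu` = `Thm418AsPrinted`) — plus the cross-`μ` separation leg; one-line instances of ✔ `Liu2021/AppendixC/UniformOmegaCiteLegs.lean`
along `restOfCharRep_eq_rest` (`rfl`).  Theorems only; count-neutral; HC_CM is NOT proved; «Δ2 BRIDGE CLOSED» is NOT claimed.
-/
import Summits.HodgeConjecture.CorCM.B01.Transposition.Item6UniformOmegaRep
import Literature.NumberTheory.Automorphic.Liu2021.AppendixC.UniformOmegaCiteLegs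
import HarnessLib

set_option autoImplicit false

/-!
# `h411` and `hsep` at `Model.uniformOmegaRep` from the AS-PRINTED families at the model's rests

With `U := Model.uniformOmegaRep h F ι₁ V Φ e dV hdV hdV0 ιV δ′ r` and the one-object tails, `U.rest (restTailOne …)` IS `restOfCharRep … δ′ (r μ hμ) μ hμ hw`
(`Model.restOfCharRep_eq_rest`, `rfl`), so:

* `Model.adjectives_rhoAt_uniformOmegaRep_of_def411AsPrinted` — `(∀ μ hμ hw, Def411AsPrinted (toThm418Data C (restOfCharRep … δ′ (r μ hμ) μ hμ hw)))` ⟹ the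
  pay-off's `h411` at `U.prop413Data H`;
* `Model.admTriple_eq_of_areIsomorphic_uniformOmegaRep_of_thm418AsPrinted` — `(∀ μ hμ hw, Thm418AsPrinted (toThm418Data C (restOfCharRep … δ′ (r μ hμ) μ hμ hw)))`
  (the displayed `hLiu` family at δ′) + `hμsep` (cross-`μ` leg, [Liu2021] App. D Lem. D.1 (3) shape) ⟹ the pay-off's `hsep` at `U.prop413Data H`.

## References
* [Liu2021] Y. Liu, *Fourier–Jacobi cycles and arithmetic relative trace formula*, Camb. J. Math. 9 (2021) 1–147 = arXiv:2102.11518 —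
  Def. 4.11 (FJcycle.tex ll. 2083–2097), Prop. 4.13 (ll. 2113–2119), Thm. 4.18 (2) (l. 2241), App. D Lem. D.1 (3) (l. 5233).
* Tree: `Transposition/Item6UniformOmegaRep.lean`, `Transposition/Item6RestOfCharRep.lean`, `Liu2021/AppendixC/UniformOmegaCiteLegs.lean`,
  `Liu2021/AppendixC/Prop413DataOfRestOne.lean` (`restTailOne`).

HC_CM is NOT proved.
-/

noncomputable section

namespace Summit.HodgeConjecture.CorCM.Model

open NumberField
open Literature.AlgebraicGeometry.Motives
open Literature.AlgebraicGeometry.ShimuraVarieties.UnitaryCanonicalModel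
open Literature.NumberTheory.Automorphic
open Literature.NumberTheory.Automorphic.IdeleClassGroup
open Literature.NumberTheory.Automorphic.Liu2021
open Literature.NumberTheory.Automorphic.Liu2021.AppendixC
open Literature.NumberTheory.Automorphic.Liu2021.AppendixC.RestOne
open Literature.NumberTheory.Automorphic.Liu2021.Def411WeilCarriers (Rep)
open Literature.NumberTheory.GelbartRogawski1991 Literature.NumberTheory.GelbartRogawski1991.UnitaryDualPair
open Literature.RepresentationTheory
open Summit.HodgeConjecture.CorCM.Transposition

section Frame

-- (every binder explicit per theorem — no section `variable` carrying the named fact `h`, per operator l.11347)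

/-- **`h411` at the model's μ-uniform carriers from [Liu2021, Def. 4.11] AS PRINTED at the generic rests `restOfCharRep … δ′ (r μ hμ) μ hμ hw`.**
[cite: Liu2021, Def. 4.11 (ll. 2083–2097)] -/
theorem adjectives_rhoAt_uniformOmegaRep_of_def411AsPrinted
    (h : exists_recordSystem) (F : CMField) [IsGalois ℚ F] (h6 : 6 ≤ Module.finrank ℚ F)
    (ι₁ : F →+* ℂ) (V : HermSpace3 F ι₁) (Φ : CMType F) {n : ℕ} (e : Fin 3 × Fin 1 ≃ Fin n) (dV : Fin 3 → F)
    (hdV : ∀ i, IsCMField.complexConj F (dV i) = dV i) (hdV0 : ∀ i, dV i ≠ 0)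
    (ιV : (sec42DataOf h isoOf F ι₁ V Φ).G →*
      UnitaryGroup.finAdelic ↥(maximalRealSubfield F) F (IsCMField.complexConj F) 3 (Matrix.diagonal dV))
    (δ' : F) (r : ∀ μ : IdeleClassGroup F →ₜ* Circle,
      IdeleClassGroup.IsConjugateSymplectic F μ → Rep ↥(maximalRealSubfield F) (imagUnitSq F))
    (H : Type) [AddCommGroup H] [Module ℂ H] [Module (MonoidAlgebra ℂ (sec42DataOf h isoOf F ι₁ V Φ).G) H]
    [IsScalarTower ℂ (MonoidAlgebra ℂ (sec42DataOf h isoOf F ι₁ V Φ).G) H]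
    (h411R : ∀ (μ : IdeleClassGroup F →ₜ* Circle) (hμ : IdeleClassGroup.IsConjugateSymplectic F μ)
      (hw : IdeleClassGroup.HasWeight F μ 1),
      Def411AsPrinted (toThm418Data (sec42DataOf h isoOf F ι₁ V Φ) (restOfCharRep h F h6 ι₁ V Φ e dV hdV hdV0 ιV δ' (r μ hμ) μ hμ hw)))
    (t : ((uniformOmegaRep h F ι₁ V Φ e dV hdV hdV0 ιV δ' r).prop413Data H).AdmTriple) :
    IsIrreducibleOrZero (((uniformOmegaRep h F ι₁ V Φ e dV hdV hdV0 ιV δ' r).prop413Data H).rhoAt t) ∧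
      IsSmoothRep (((uniformOmegaRep h F ι₁ V Φ e dV hdV hdV0 ιV δ' r).prop413Data H).rhoAt t) ∧
      IsAdmissibleRep (((uniformOmegaRep h F ι₁ V Φ e dV hdV hdV0 ιV δ' r).prop413Data H).rhoAt t) :=
  (uniformOmegaRep h F ι₁ V Φ e dV hdV hdV0 ιV δ' r).adjectives_rhoAt_prop413Data_of_def411AsPrinted_rest H
    (fun μ hμ hw => restTailOne (AlgHom.id ℚ F) ι₁ hμ hw (Def45.Carriers.ofPolDR μ (Def45.PolDR ι₁ hμ (Def45.RMuForm ι₁ hμ)))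
      ((heckeTranslatesFamilyOf heckeTranslate_definedOver_holds h isoOf F ι₁ V Φ h6).rhoΩOne (AlgHom.id ℚ F) ι₁ hμ hw
        (Def45.Carriers.ofPolDR μ (Def45.PolDR ι₁ hμ (Def45.RMuForm ι₁ hμ)))))
    h411R t

/-- **`hsep` at the model's μ-uniform carriers from [Liu2021, Thm. 4.18 (2)] AS PRINTED at the generic rests** (the displayed `hLiu` family at δ′)
**+ the cross-`μ` separation leg `hμsep`** ([Liu2021] App. D Lem. D.1 (3) shape).
[cite: Liu2021, Thm. 4.18 (2) (l. 2241); App. D Lemma D.1 (3) (l. 5233)] -/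
theorem admTriple_eq_of_areIsomorphic_uniformOmegaRep_of_thm418AsPrinted
    (h : exists_recordSystem) (F : CMField) [IsGalois ℚ F] (h6 : 6 ≤ Module.finrank ℚ F)
    (ι₁ : F →+* ℂ) (V : HermSpace3 F ι₁) (Φ : CMType F) {n : ℕ} (e : Fin 3 × Fin 1 ≃ Fin n) (dV : Fin 3 → F)
    (hdV : ∀ i, IsCMField.complexConj F (dV i) = dV i) (hdV0 : ∀ i, dV i ≠ 0)
    (ιV : (sec42DataOf h isoOf F ι₁ V Φ).G →*
      UnitaryGroup.finAdelic ↥(maximalRealSubfield F) F (IsCMField.complexConj F) 3 (Matrix.diagonal dV))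
    (δ' : F) (r : ∀ μ : IdeleClassGroup F →ₜ* Circle,
      IdeleClassGroup.IsConjugateSymplectic F μ → Rep ↥(maximalRealSubfield F) (imagUnitSq F))
    (H : Type) [AddCommGroup H] [Module ℂ H] [Module (MonoidAlgebra ℂ (sec42DataOf h isoOf F ι₁ V Φ).G) H]
    [IsScalarTower ℂ (MonoidAlgebra ℂ (sec42DataOf h isoOf F ι₁ V Φ).G) H]
    (hLiuR : ∀ (μ : IdeleClassGroup F →ₜ* Circle) (hμ : IdeleClassGroup.IsConjugateSymplectic F μ)
      (hw : IdeleClassGroup.HasWeight F μ 1),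
      Thm418AsPrinted (toThm418Data (sec42DataOf h isoOf F ι₁ V Φ) (restOfCharRep h F h6 ι₁ V Φ e dV hdV hdV0 ιV δ' (r μ hμ) μ hμ hw)))
    (hμsep : ∀ s t : ((uniformOmegaRep h F ι₁ V Φ e dV hdV hdV0 ιV δ' r).prop413Data H).AdmTriple,
      Nontrivial (((uniformOmegaRep h F ι₁ V Φ e dV hdV hdV0 ιV δ' r).prop413Data H).omegaAt s) →
      (∃ f : ((uniformOmegaRep h F ι₁ V Φ e dV hdV hdV0 ιV δ' r).prop413Data H).omegaAt s ≃ₗ[ℂ]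
          ((uniformOmegaRep h F ι₁ V Φ e dV hdV hdV0 ιV δ' r).prop413Data H).omegaAt t,
        ∀ (g : (sec42DataOf h isoOf F ι₁ V Φ).G) (v : ((uniformOmegaRep h F ι₁ V Φ e dV hdV hdV0 ιV δ' r).prop413Data H).omegaAt s),
          f ((((uniformOmegaRep h F ι₁ V Φ e dV hdV hdV0 ιV δ' r).prop413Data H).rhoAt s) g v) =
            (((uniformOmegaRep h F ι₁ V Φ e dV hdV hdV0 ιV δ' r).prop413Data H).rhoAt t) g (f v)) → s.1.μ = t.1.μ)
    (s t : ((uniformOmegaRep h F ι₁ V Φ e dV hdV hdV0 ιV δ' r).prop413Data H).AdmTriple)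
    (hs : Nontrivial (((uniformOmegaRep h F ι₁ V Φ e dV hdV hdV0 ιV δ' r).prop413Data H).omegaAt s))
    (hst : ∃ f : ((uniformOmegaRep h F ι₁ V Φ e dV hdV hdV0 ιV δ' r).prop413Data H).omegaAt s ≃ₗ[ℂ]
        ((uniformOmegaRep h F ι₁ V Φ e dV hdV hdV0 ιV δ' r).prop413Data H).omegaAt t,
      ∀ (g : (sec42DataOf h isoOf F ι₁ V Φ).G) (v : ((uniformOmegaRep h F ι₁ V Φ e dV hdV hdV0 ιV δ' r).prop413Data H).omegaAt s),
        f ((((uniformOmegaRep h F ι₁ V Φ e dV hdV hdV0 ιV δ' r).prop413Data H).rhoAt s) g v) =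
          (((uniformOmegaRep h F ι₁ V Φ e dV hdV hdV0 ιV δ' r).prop413Data H).rhoAt t) g (f v)) :
    s = t :=
  (uniformOmegaRep h F ι₁ V Φ e dV hdV hdV0 ιV δ' r).admTriple_eq_of_areIsomorphic_of_thm418AsPrinted_rest H
    (fun μ hμ hw => restTailOne (AlgHom.id ℚ F) ι₁ hμ hw (Def45.Carriers.ofPolDR μ (Def45.PolDR ι₁ hμ (Def45.RMuForm ι₁ hμ)))
      ((heckeTranslatesFamilyOf heckeTranslate_definedOver_holds h isoOf F ι₁ V Φ h6).rhoΩOne (AlgHom.id ℚ F) ι₁ hμ hw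
        (Def45.Carriers.ofPolDR μ (Def45.PolDR ι₁ hμ (Def45.RMuForm ι₁ hμ)))))
    hLiuR hμsep s t hs hst

end Frame

end Summit.HodgeConjecture.CorCM.Model

end
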